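import Literature.MathematicalPhysics.QuantumFieldTheory.Balaban1983to89.B4BoxCov237

/-!
# NE7K1LinCovEnergyAbstract — row NE7 (node U5), candidate route HOM, path H1L, cell K1-lin(s): NEEDS-ESTIMATE #E1 (o2) — B4 (1.13)–(1.15)
# AND (2.37) FOR AN ABSTRACT FINE OPERATOR `T` DOMINATING BAŁABAN'S NN BOX OPERATOR: the unit-lattice operator
# `Δ_T^{(j)} = aI − a²Q_n T⁻¹ Q_n^*`, its coercivity `γ₀I ≤ Δ_T^{(j)} + a₂L_P^{−2}P ≤ γ₁I`, and the Combes–Thomas decay of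
# `(Δ_T^{(j)} + a₂L_P^{−2}P)⁻¹` in ANY pseudo-distance dominated by the sup-distance — b04's `B4BoxCov237` §3–§7 with the fine
# operator a HYPOTHESIS (three clauses: `T·T⁻¹ = 1`, `T` symmetric, `⟨g, boxOpR(n,a,0) g⟩ ≤ ⟨g, T g⟩`)

Lineage `b2b-balaban-t4-ne7-p2` (CRUX PROVER NE7 #2), generation 77; file 83.  File 80 ran b04's (1.13)–(1.15) for the two-cutoff line on a
Neumann BOX (`boxLine`); the only properties of the line it used were `boxLine_mul_inv`, `boxLine_isSymm` and the Löwner lever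
`boxOpR_form_le_boxLine`.  THIS FILE records the argument ONCE for an arbitrary real matrix `T` on b04's fine index `↥(boxDom (n·M))` with those
three properties as displayed hypotheses, and adds the decay step of file 81 over an arbitrary pseudo-distance `ρ` on the unit sites with
`ρ ≤ |·−·|_∞` and a uniform lattice-sum profile — so that the TORUS variant of (2.37) (PRICING-NE7 v39 N-40-5 «torus first», v40 A-41-6: the
fine doubled-torus line dominates `boxOpR n a 0 (2M)` on the representatives by `NE7K1LinTorusChart.form_torOpK_ge`) and the box case are
both instances (file 84: the torus instance; file 80∕81 = the box instance written out).

* §1 `KeffG n M a T = a·1 − (a²∕n^{d+1})·indB·T⁻¹·indBᵀ` (B4 (1.14)); `KeffG_isSymm`, `KeffG_form_eq`, `inv_form_nonneg_of`, `KeffG_form_le`,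
  `gStarG`, `energyG_expand`, **`KeffG_form_eq_energy`** (uses only `T·T⁻¹ = 1`), **`fineEnergyG_ge`** (from the lever + b04's `fineEnergy_ge` at
  `m² = 0`), **`KeffG_form_ge`**: `min(a∕(8(d+1)), 1∕8)·E_□(ψ) ≤ ⟨ψ, Δ_Tψ⟩` (b04's `Keff_form_ge` verbatim; `E_□` = the Neumann bond form of the
  unit box of representatives — on a torus a LOWER bound for the periodic one, which is all coercivity needs).
* §2 `covOpG n ℓ M′ a a₂ T = KeffG + (a₂∕L_P²)·P` (B4 (1.13)); `covOpG_isSymm`, **`covOpG_form_ge`** (`γ₀ = min(min(a∕(8(d+1)),1∕8)∕(ℓ(ℓ+1)∕2), a₂∕L_P²)`,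
  b04's block Poincaré — intra-block bonds only), `covOpG_isUnit ∕ _mul_inv`, `covOpG_form_le`.
* (file 83b `NE7K1LinCovDecayAbstract`) §3 DECAY OVER A PSEUDO-DISTANCE: given a block-row bound `|Σ_{x′ ∈ B(y′)} T⁻¹(x, x′)| ≤ C·e^{−κ·ρ(blk x, y′)}` for a pseudo-distance `ρ` on the unit
  sites with `ρ(y,y′) ≤ |y − y′|_∞` and `Σ_{y′} e^{−tρ(y,y′)} ≤ K(t)`: `blockSumG_bound`, **`KeffG_entry_bound`** (`|Δ_T(y,y′)| ≤ (a + a²C)e^{−κρ(y,y′)}`),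
  **`covOpG_hyp56`** (b04's condition (5.6) with constants `γ₀(d,ℓ,a₋,a₂₋)`, `c₀ = |a₊| + a₊²C + |a₂₊|e^{κℓ}`, rate `κ`), and **`covOpG_inv_decay`**:
  `|(Δ_T + a₂L_P^{−2}P)⁻¹(y,y′)| ≤ (2∕γ₀)·e^{−rate(K,γ₀,c₀,κ)·ρ(y,y′)}` (`B4Sect5Torus.inv_decay` BY NAME).
Constants: functions of `(d, ℓ, a±, a₂±, C, κ)` only — whatever `T` is.

HONEST FRAMING: [folklore]; b04's audit proofs re-typed over a hypothesis; no instance in this file (files 80–81 are the box instance, file 84 the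
torus instance); nothing of Bałaban's asserted; no `sorry`.  Census only; NE7 NOT PRINTED ∕ NOT PROVED; spine 0∕9; FIXED FINITE T⁴, rung (B)+1;
NOT infinite volume, NOT mass gap, NOT Clay.  HONEST DEPENDENCY: continuum YM on T⁴ ⇐ BetaPertH ∧ nine spine estimates (0/9 proved); BetaPertH ⇐
(D1) ∧ (D4) ∧ CAP+tail; G-an2-4 gates asym, D1 and NE2/3/4.
-/

noncomputable section

open Finset Matrix

namespace Summit.QuantumFields.BalabanUV.T4Continuum.NE7K1LinCovEnergyAbstract

open Literature.MathematicalPhysics.QuantumFieldTheory.Balaban1983to89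
open Literature.MathematicalPhysics.QuantumFieldTheory.Balaban1983to89.B4Reflection242
open Literature.MathematicalPhysics.QuantumFieldTheory.Balaban1983to89.B4ContourShift (supNorm supNorm_nonneg)
open Literature.MathematicalPhysics.QuantumFieldTheory.Balaban1983to89.B4BoxCov237
open Literature.MathematicalPhysics.QuantumFieldTheory.Balaban1983to89.B4Green242Bridge (boxNbrs)
open Literature.MathematicalPhysics.QuantumFieldTheory.Balaban1983to89.B4Green244 (finePt)
open Literature.MathematicalPhysics.QuantumFieldTheory.Balaban1983to89.B4Sect5Torus (IsPseudoDist SumBound Hyp56 rate rate_pos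
  inv_decay)
open Literature.MathematicalPhysics.QuantumFieldTheory.Balaban1983to89.Beta.BlockPoincare (avg coercive_of_blockPoincare
  card_mul_avg_sq_le)

variable {d : ℕ}

/-! ### §1 `Δ_T^{(j)} = aI − a²Q_nT⁻¹Q_n^*` for an abstract fine operator `T` -/

section Keff

variable {n : ℕ} {M : Fin (d + 1) → ℕ}

/-- **B4 (1.14) OVER AN ABSTRACT FINE OPERATOR**: `Δ_T = a·1 − (a²∕n^{d+1})·indB·T⁻¹·indBᵀ` on the unit sites `boxDom M`. [folklore] -/
def KeffG (n : ℕ) (M : Fin (d + 1) → ℕ) (a : ℝ) (T : Matrix ↥(boxDom fun i => n * M i) ↥(boxDom fun i => n * M i) ℝ) :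
    Matrix ↥(boxDom M) ↥(boxDom M) ℝ :=
  a • (1 : Matrix ↥(boxDom M) ↥(boxDom M) ℝ) - (a ^ 2 * ((n : ℝ) ^ (d + 1))⁻¹) • (indB n M * T⁻¹ * (indB n M)ᵀ)

variable (T : Matrix ↥(boxDom fun i => n * M i) ↥(boxDom fun i => n * M i) ℝ)

/-- `Δ_T` is symmetric when `T` is. [folklore] -/
theorem KeffG_isSymm (hTs : T.IsSymm) (a : ℝ) : (KeffG n M a T).IsSymm := by
  have hG : (T⁻¹).IsSymm := hTs.inv
  unfold Matrix.IsSymm at hG ⊢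
  simp only [KeffG, Matrix.transpose_sub, Matrix.transpose_smul, Matrix.transpose_one, Matrix.transpose_mul,
    Matrix.transpose_transpose, hG, Matrix.mul_assoc]

/-- the form of `Δ_T`: `ψ ⬝ Δ_Tψ = a‖ψ‖² − (a²∕n^{d+1})·(indBᵀψ) ⬝ T⁻¹(indBᵀψ)`. [folklore] -/
theorem KeffG_form_eq (a : ℝ) (ψ : ↥(boxDom M) → ℝ) :
    ψ ⬝ᵥ (KeffG n M a T).mulVec ψ
      = a * (ψ ⬝ᵥ ψ) - a ^ 2 * ((n : ℝ) ^ (d + 1))⁻¹ * ((indB n M)ᵀ.mulVec ψ ⬝ᵥ (T⁻¹).mulVec ((indB n M)ᵀ.mulVec ψ)) := by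
  rw [KeffG, Matrix.sub_mulVec, Matrix.smul_mulVec, Matrix.one_mulVec, dotProduct_sub, dotProduct_smul,
    smul_eq_mul, Matrix.smul_mulVec, dotProduct_smul, smul_eq_mul, ← Matrix.mulVec_mulVec, ← Matrix.mulVec_mulVec,
    Matrix.dotProduct_mulVec ψ (indB n M), ← Matrix.mulVec_transpose]

/-- the lever implies the fine form is nonnegative (`a ≥ 0`). [folklore] -/
theorem form_nonneg_of_lever {a : ℝ} (ha : 0 ≤ a)
    (hlev : ∀ g, g ⬝ᵥ (boxOpR n a 0 M).mulVec g ≤ g ⬝ᵥ T.mulVec g) (g : ↥(boxDom fun i => n * M i) → ℝ) :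
    0 ≤ g ⬝ᵥ T.mulVec g :=
  le_trans (boxOpR_form_nonneg n ha le_rfl M g) (hlev g)

/-- the Green form of `T` is nonnegative: `0 ≤ ⟨w, T⁻¹w⟩`. [folklore] -/
theorem inv_form_nonneg_of {a : ℝ} (ha : 0 ≤ a) (hTG : T * T⁻¹ = 1)
    (hlev : ∀ g, g ⬝ᵥ (boxOpR n a 0 M).mulVec g ≤ g ⬝ᵥ T.mulVec g) (w : ↥(boxDom fun i => n * M i) → ℝ) :
    0 ≤ w ⬝ᵥ (T⁻¹).mulVec w := by
  set u := (T⁻¹).mulVec w with hu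
  have hw : T.mulVec u = w := by rw [hu, Matrix.mulVec_mulVec, hTG, Matrix.one_mulVec]
  calc (0 : ℝ) ≤ u ⬝ᵥ T.mulVec u := form_nonneg_of_lever T ha hlev u
    _ = w ⬝ᵥ u := by rw [hw, dotProduct_comm]

/-- **UPPER BOUND** `ψ ⬝ Δ_Tψ ≤ a‖ψ‖²`. [folklore] -/
theorem KeffG_form_le {a : ℝ} (ha : 0 < a) (hTG : T * T⁻¹ = 1)
    (hlev : ∀ g, g ⬝ᵥ (boxOpR n a 0 M).mulVec g ≤ g ⬝ᵥ T.mulVec g) (ψ : ↥(boxDom M) → ℝ) :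
    ψ ⬝ᵥ (KeffG n M a T).mulVec ψ ≤ a * (ψ ⬝ᵥ ψ) := by
  rw [KeffG_form_eq]
  have h := inv_form_nonneg_of T ha.le hTG hlev ((indB n M)ᵀ.mulVec ψ)
  have : 0 ≤ a ^ 2 * ((n : ℝ) ^ (d + 1))⁻¹ * ((indB n M)ᵀ.mulVec ψ ⬝ᵥ (T⁻¹).mulVec ((indB n M)ᵀ.mulVec ψ)) :=
    mul_nonneg (by positivity) h
  linarith

/-- the minimiser `g⋆ = a·T⁻¹(indBᵀψ)`. [folklore] -/
def gStarG (n : ℕ) (M : Fin (d + 1) → ℕ) (a : ℝ) (T : Matrix ↥(boxDom fun i => n * M i) ↥(boxDom fun i => n * M i) ℝ)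
    (ψ : ↥(boxDom M) → ℝ) : ↥(boxDom fun i => n * M i) → ℝ :=
  a • (T⁻¹).mulVec ((indB n M)ᵀ.mulVec ψ)

/-- completing the square (b04's `energy_expand` with `boxOpR ↦ T`). [folklore] -/
theorem energyG_expand (a : ℝ) (ψ : ↥(boxDom M) → ℝ) (g : ↥(boxDom fun i => n * M i) → ℝ) :
    a * (∑ y, (ψ y - ((n : ℝ) ^ (d + 1))⁻¹ * (indB n M).mulVec g y) ^ 2)
      + ((n : ℝ) ^ (d + 1))⁻¹ * (g ⬝ᵥ T.mulVec g - a * ((n : ℝ) ^ (d + 1))⁻¹ * ∑ y, (indB n M).mulVec g y ^ 2)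
      = a * (ψ ⬝ᵥ ψ) - 2 * a * ((n : ℝ) ^ (d + 1))⁻¹ * ((indB n M)ᵀ.mulVec ψ ⬝ᵥ g)
        + ((n : ℝ) ^ (d + 1))⁻¹ * (g ⬝ᵥ T.mulVec g) := by
  have hcross : (indB n M)ᵀ.mulVec ψ ⬝ᵥ g = ∑ y, ψ y * (indB n M).mulVec g y := by
    rw [Matrix.mulVec_transpose, ← Matrix.dotProduct_mulVec]
    rfl
  have hsq : ∑ y, (ψ y - ((n : ℝ) ^ (d + 1))⁻¹ * (indB n M).mulVec g y) ^ 2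
      = (ψ ⬝ᵥ ψ) - 2 * ((n : ℝ) ^ (d + 1))⁻¹ * (∑ y, ψ y * (indB n M).mulVec g y)
        + (((n : ℝ) ^ (d + 1))⁻¹) ^ 2 * ∑ y, (indB n M).mulVec g y ^ 2 := by
    unfold dotProduct
    rw [Finset.mul_sum, Finset.mul_sum, ← Finset.sum_sub_distrib, ← Finset.sum_add_distrib]
    refine Finset.sum_congr rfl fun y _ => ?_
    ring
  rw [hsq, hcross]
  ring

/-- **THE VARIATIONAL VALUE** `ψ ⬝ Δ_Tψ = a‖ψ − Q g⋆‖² + N⁻¹·(g⋆ ⬝ Tg⋆ − (a∕N)‖indB g⋆‖²)` (uses only `T·T⁻¹ = 1`). [folklore] -/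
theorem KeffG_form_eq_energy {a : ℝ} (hTG : T * T⁻¹ = 1) (ψ : ↥(boxDom M) → ℝ) :
    ψ ⬝ᵥ (KeffG n M a T).mulVec ψ
      = a * (∑ y, (ψ y - ((n : ℝ) ^ (d + 1))⁻¹ * (indB n M).mulVec (gStarG n M a T ψ) y) ^ 2)
        + ((n : ℝ) ^ (d + 1))⁻¹ * (gStarG n M a T ψ ⬝ᵥ T.mulVec (gStarG n M a T ψ)
            - a * ((n : ℝ) ^ (d + 1))⁻¹ * ∑ y, (indB n M).mulVec (gStarG n M a T ψ) y ^ 2) := by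
  rw [energyG_expand, KeffG_form_eq]
  set G := T⁻¹
  set φ := (indB n M)ᵀ.mulVec ψ
  have hT : ∀ v, T.mulVec (G.mulVec v) = v := fun v => by rw [Matrix.mulVec_mulVec, hTG, Matrix.one_mulVec]
  have hg : gStarG n M a T ψ = a • G.mulVec φ := rfl
  rw [hg]
  have h1 : a • G.mulVec φ ⬝ᵥ T.mulVec (a • G.mulVec φ) = a * (a * (φ ⬝ᵥ G.mulVec φ)) := by
    rw [Matrix.mulVec_smul, hT, smul_dotProduct, dotProduct_smul, smul_eq_mul, smul_eq_mul, dotProduct_comm]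
  have h2 : φ ⬝ᵥ a • G.mulVec φ = a * (φ ⬝ᵥ G.mulVec φ) := by rw [dotProduct_smul, smul_eq_mul]
  rw [h1, h2]
  ring

/-- **THE FINE KINETIC FORM UNDER THE LEVER**: `(n²∕2)·ΣΣ(g x − g x′)² ≤ g ⬝ Tg − (a∕N)·Σ_y (indB g)_y²`. [folklore] -/
theorem fineEnergyG_ge (hn : 1 ≤ n) (a : ℝ) (hlev : ∀ g, g ⬝ᵥ (boxOpR n a 0 M).mulVec g ≤ g ⬝ᵥ T.mulVec g)
    (g : ↥(boxDom fun i => n * M i) → ℝ) :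
    (n : ℝ) ^ 2 / 2 * (∑ x, ∑ x' ∈ boxNbrs (fun i => n * M i) x, (g x - g x') ^ 2)
      ≤ g ⬝ᵥ T.mulVec g - a * ((n : ℝ) ^ (d + 1))⁻¹ * ∑ y, (indB n M).mulVec g y ^ 2 := by
  have h0 := fineEnergy_ge hn a (le_refl (0 : ℝ)) M g
  have h1 := hlev g
  linarith

/-- **COERCIVITY OF `Δ_T` BY THE UNIT BOND FORM OF THE REPRESENTATIVES' BOX**: `min(a∕(8(d+1)), 1∕8)·E_□(ψ) ≤ ψ ⬝ Δ_Tψ` (b04's `Keff_form_ge`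
re-run over the hypothesis). [folklore] -/
theorem KeffG_form_ge (hn : 1 ≤ n) {a : ℝ} (ha : 0 < a) (hTG : T * T⁻¹ = 1)
    (hlev : ∀ g, g ⬝ᵥ (boxOpR n a 0 M).mulVec g ≤ g ⬝ᵥ T.mulVec g) (ψ : ↥(boxDom M) → ℝ) :
    min (a / (8 * (d + 1))) (1 / 8) * dirBox M (extB M ψ) ≤ ψ ⬝ᵥ (KeffG n M a T).mulVec ψ := by
  have hn0 : (0 : ℝ) < n := by exact_mod_cast hn
  set N : ℝ := (n : ℝ) ^ (d + 1) with hNdef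
  have hN0 : 0 < N := by positivity
  set g := gStarG n M a T ψ with hg
  set w := (indB n M).mulVec g with hw
  set Q : ↥(boxDom M) → ℝ := N⁻¹ • w with hQ
  set A : ℝ := ∑ y, (ψ y - N⁻¹ * w y) ^ 2 with hA
  set B : ℝ := g ⬝ᵥ T.mulVec g - a * N⁻¹ * ∑ y, w y ^ 2 with hB
  set U : ℝ := ∑ x, ∑ x' ∈ boxNbrs (fun i => n * M i) x, (g x - g x') ^ 2 with hU
  have hF : ψ ⬝ᵥ (KeffG n M a T).mulVec ψ = a * A + N⁻¹ * B := KeffG_form_eq_energy T (a := a) hTG ψ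
  have hA0 : 0 ≤ A := Finset.sum_nonneg fun _ _ => sq_nonneg _
  have hU0 : 0 ≤ U := Finset.sum_nonneg fun _ _ => Finset.sum_nonneg fun _ _ => sq_nonneg _
  have hBU : (n : ℝ) ^ 2 / 2 * U ≤ B := fineEnergyG_ge T hn a hlev g
  have hB0 : 0 ≤ B := le_trans (mul_nonneg (by positivity) hU0) hBU
  have hsplit : extB M ψ = extB M (ψ - Q) + extB M Q := by rw [← extB_add, sub_add_cancel]
  have hE1 : dirBox M (extB M (ψ - Q)) ≤ 4 * (d + 1) * A := by
    have h := dirBox_extB_le_norm (ψ - Q)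
    have hAA : (ψ - Q) ⬝ᵥ (ψ - Q) = A := by
      rw [hA]
      unfold dotProduct
      refine Finset.sum_congr rfl fun y _ => ?_
      simp only [hQ, Pi.sub_apply, Pi.smul_apply, smul_eq_mul]
      ring
    rw [hAA] at h
    exact h
  have hE2 : dirBox M (extB M Q) ≤ 4 * N⁻¹ * B := by
    have h := dirBox_blockAvg_le hn M g
    calc dirBox M (extB M Q) ≤ 2 * (n : ℝ) ^ 2 * N⁻¹ * U := h
      _ = 4 * N⁻¹ * ((n : ℝ) ^ 2 / 2 * U) := by ring
      _ ≤ 4 * N⁻¹ * B := mul_le_mul_of_nonneg_left hBU (by positivity)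
  have hE : dirBox M (extB M ψ) ≤ 8 * (d + 1) * A + 8 * N⁻¹ * B := by
    rw [hsplit]
    have := dirBox_add_le M (extB M (ψ - Q)) (extB M Q)
    linarith
  set c : ℝ := min (a / (8 * (d + 1))) (1 / 8) with hc
  have hc0 : 0 ≤ c := le_min (by positivity) (by norm_num)
  have hc1 : c * (8 * (d + 1)) ≤ a := by
    have : c ≤ a / (8 * (d + 1)) := min_le_left _ _
    have hd : (0 : ℝ) < 8 * (d + 1) := by positivity
    calc c * (8 * (d + 1)) ≤ a / (8 * (d + 1)) * (8 * (d + 1)) := mul_le_mul_of_nonneg_right this hd.le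
      _ = a := div_mul_cancel₀ a hd.ne'
  have hc2 : c * 8 ≤ 1 := by
    have : c ≤ 1 / 8 := min_le_right _ _
    linarith
  rw [hF]
  calc c * dirBox M (extB M ψ) ≤ c * (8 * (d + 1) * A + 8 * N⁻¹ * B) := mul_le_mul_of_nonneg_left hE hc0
    _ = c * (8 * (d + 1)) * A + c * 8 * (N⁻¹ * B) := by ring
    _ ≤ a * A + 1 * (N⁻¹ * B) :=
        add_le_add (mul_le_mul_of_nonneg_right hc1 hA0) (mul_le_mul_of_nonneg_right hc2 (mul_nonneg (inv_nonneg.2 hN0.le) hB0))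
    _ = a * A + N⁻¹ * B := by ring

end Keff

/-! ### §2 `Δ_T + a₂L_P^{−2}P` and its coercivity (B4 Prop. 2.3 (1.15)) -/

section Cov

variable {n ℓ : ℕ} {M' : Fin (d + 1) → ℕ}

/-- **B4 (1.13) OVER THE HYPOTHESIS**: `Δ_T + a₂L_P^{−2}P` on the unit box of side lengths `L_P·M′`, `L_P = ℓ + 1`, `P = blockAvgP`. [folklore] -/
def covOpG (n ℓ : ℕ) (M' : Fin (d + 1) → ℕ) (a a₂ : ℝ)
    (T : Matrix ↥(boxDom fun i => n * ((ℓ + 1) * M' i)) ↥(boxDom fun i => n * ((ℓ + 1) * M' i)) ℝ) :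
    Matrix ↥(boxDom fun i => (ℓ + 1) * M' i) ↥(boxDom fun i => (ℓ + 1) * M' i) ℝ :=
  KeffG n (fun i => (ℓ + 1) * M' i) a T + (a₂ / ((ℓ : ℝ) + 1) ^ 2) • blockAvgP ℓ M'

variable (T : Matrix ↥(boxDom fun i => n * ((ℓ + 1) * M' i)) ↥(boxDom fun i => n * ((ℓ + 1) * M' i)) ℝ)

/-- symmetry. [folklore] -/
theorem covOpG_isSymm (hTs : T.IsSymm) (a a₂ : ℝ) : (covOpG n ℓ M' a a₂ T).IsSymm := by
  unfold covOpG
  exact (KeffG_isSymm T hTs a).add ((blockAvgP_isSymm ℓ M').smul _)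

/-- **COERCIVITY** (lower half of (1.15)): `γ₀‖ω‖² ≤ ⟨ω, (Δ_T + a₂L_P^{−2}P)ω⟩`, `γ₀ = min(min(a∕(8(d+1)), 1∕8)∕(ℓ(ℓ+1)∕2), a₂∕L_P²)`. [folklore] -/
theorem covOpG_form_ge (hn : 1 ≤ n) (hℓ : 1 ≤ ℓ) {a a₂ : ℝ} (ha : 0 < a) (ha2 : 0 ≤ a₂) (hTG : T * T⁻¹ = 1)
    (hlev : ∀ g, g ⬝ᵥ (boxOpR n a 0 (fun i => (ℓ + 1) * M' i)).mulVec g ≤ g ⬝ᵥ T.mulVec g)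
    (ω : ↥(boxDom fun i => (ℓ + 1) * M' i) → ℝ) :
    min (min (a / (8 * (d + 1))) (1 / 8) / ((ℓ : ℝ) * (ℓ + 1) / 2)) (a₂ / ((ℓ : ℝ) + 1) ^ 2) * (ω ⬝ᵥ ω)
      ≤ ω ⬝ᵥ (covOpG n ℓ M' a a₂ T).mulVec ω := by
  have hℓ1 : (1 : ℝ) ≤ ℓ := by exact_mod_cast hℓ
  have hP : (0 : ℝ) < (ℓ : ℝ) * (ℓ + 1) / 2 := by positivity
  refine coercive_of_blockPoincare (lblk ℓ M') bsrc btgt _ hP (lblock_poincare hℓ M') (covOpG n ℓ M' a a₂ T) _ _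
    (le_min (by positivity) (by norm_num)) (by positivity) ?_ ω
  intro ω
  rw [sum_UBond_eq_dirBox, ← blockAvgP_form]
  have hK := KeffG_form_ge T hn ha hTG hlev ω
  unfold covOpG
  rw [Matrix.add_mulVec, dotProduct_add, Matrix.smul_mulVec, dotProduct_smul, smul_eq_mul]
  linarith

/-- invertibility. [folklore] -/
theorem covOpG_isUnit (hn : 1 ≤ n) (hℓ : 1 ≤ ℓ) {a a₂ : ℝ} (ha : 0 < a) (ha2 : 0 < a₂) (hTG : T * T⁻¹ = 1)
    (hlev : ∀ g, g ⬝ᵥ (boxOpR n a 0 (fun i => (ℓ + 1) * M' i)).mulVec g ≤ g ⬝ᵥ T.mulVec g) :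
    IsUnit (covOpG n ℓ M' a a₂ T) := by
  have hℓ1 : (1 : ℝ) ≤ ℓ := by exact_mod_cast hℓ
  refine QGQInverse.isUnit_of_coercive
    (γ := min (min (a / (8 * (d + 1))) (1 / 8) / ((ℓ : ℝ) * (ℓ + 1) / 2)) (a₂ / ((ℓ : ℝ) + 1) ^ 2))
    (lt_min (by positivity) (by positivity)) ?_
  intro ω
  exact covOpG_form_ge T hn hℓ ha ha2.le hTG hlev ω

/-- `C⁻¹` is a genuine inverse. [folklore] -/
theorem covOpG_mul_inv (hn : 1 ≤ n) (hℓ : 1 ≤ ℓ) {a a₂ : ℝ} (ha : 0 < a) (ha2 : 0 < a₂) (hTG : T * T⁻¹ = 1)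
    (hlev : ∀ g, g ⬝ᵥ (boxOpR n a 0 (fun i => (ℓ + 1) * M' i)).mulVec g ≤ g ⬝ᵥ T.mulVec g) :
    covOpG n ℓ M' a a₂ T * (covOpG n ℓ M' a a₂ T)⁻¹ = 1 :=
  Matrix.mul_nonsing_inv _ ((Matrix.isUnit_iff_isUnit_det _).1 (covOpG_isUnit T hn hℓ ha ha2 hTG hlev))

/-- **BOUNDEDNESS** (upper half of (1.15)): `⟨ω, (Δ_T + a₂L_P^{−2}P)ω⟩ ≤ (a + a₂∕L_P²)‖ω‖²`. [folklore] -/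
theorem covOpG_form_le {a a₂ : ℝ} (ha : 0 < a) (ha2 : 0 ≤ a₂) (hTG : T * T⁻¹ = 1)
    (hlev : ∀ g, g ⬝ᵥ (boxOpR n a 0 (fun i => (ℓ + 1) * M' i)).mulVec g ≤ g ⬝ᵥ T.mulVec g)
    (ω : ↥(boxDom fun i => (ℓ + 1) * M' i) → ℝ) :
    ω ⬝ᵥ (covOpG n ℓ M' a a₂ T).mulVec ω ≤ (a + a₂ / ((ℓ : ℝ) + 1) ^ 2) * (ω ⬝ᵥ ω) := by
  have hK := KeffG_form_le T ha hTG hlev ω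
  have hPle : ω ⬝ᵥ (blockAvgP ℓ M').mulVec ω ≤ ω ⬝ᵥ ω := by
    rw [blockAvgP_form]
    have hn2 : ω ⬝ᵥ ω = ∑ y, ω y ^ 2 := by
      unfold dotProduct
      exact Finset.sum_congr rfl fun y _ => by ring
    rw [hn2, ← Finset.sum_fiberwise_of_maps_to (s := Finset.univ) (t := Finset.univ) (g := lblk ℓ M')
      (fun y _ => Finset.mem_univ _) (f := fun y => ω y ^ 2)]
    exact Finset.sum_le_sum fun b _ => card_mul_avg_sq_le _ ω
  unfold covOpG
  rw [Matrix.add_mulVec, dotProduct_add, Matrix.smul_mulVec, dotProduct_smul, smul_eq_mul, add_mul]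
  have : a₂ / ((ℓ : ℝ) + 1) ^ 2 * (ω ⬝ᵥ (blockAvgP ℓ M').mulVec ω) ≤ a₂ / ((ℓ : ℝ) + 1) ^ 2 * (ω ⬝ᵥ ω) :=
    mul_le_mul_of_nonneg_left hPle (by positivity)
  linarith

end Cov

end Summit.QuantumFields.BalabanUV.T4Continuum.NE7K1LinCovEnergyAbstract

end
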